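import Literature.AlgebraicGeometry.Resolution.CentreBlowupAdaptedOrder
import Mathlib.Algebra.MvPolynomial.PDeriv
import Mathlib.Algebra.CharP.Defs
import HarnessLib

/-!
# [Cossart–Piltant 2019, Remark 2.6]: `ω(x)` is not determined by the characteristic polyhedron — computed in the model

`PointBlowupAdaptedOrder` / `CentreBlowupAdaptedOrder` type Cossart–Piltant's boundary-adapted
numbers `H_j`, `ε(x)`, `V(F_{p,Z},E,m_S) ≠ 0` (read through Prop. 2.16 (i): "`V(F_{p,Z},E,m_S) = 0 ⟺
F_{p,Z} ∈ S/m_S[U₁,…,U_e][U_{e+1}^p,…,U_n^p]`", i.e. `∂F_{p,Z}/∂U_j ≠ 0` for some `U_j ∉ E`) and the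
adapted order `ω(x)` (Def. 2.16) for `h = Z^p + F` in given coordinates.  This file computes the
paper's own illustration of Def. 2.16, [Cossart–Piltant 2019, Remark 2.6 (p. 24)]:

"Remark 2.6. It is obvious from this definition that `ω(x)` is not determined by the characteristic
polyhedra `Δ_S(h;u₁,…,u_n;Z)`, even for unspecified well adapted coordinates `(u₁,…,u_n;Z)`.
For example, take `n = 3`, `p ≥ 3` for simplicity and `k(x)` algebraically closed of characteristic
`p > 0`. Suppose: `in_{m_S} h = Z^p + U₁U₂U₃^p + U₁^{p+2} + U₂^{p+2} + c U₃U₂U₁^p`, `E = div(u₁u₂)`,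
where `c ∈ k(x)`. […] `Δ_S(h;u'₁,u'₂,u'₃;Z') = Conv({v₁,v₂,v₃}) ⊂ {x₁+x₂+x₃ = δ(x) = 1 + 2/p}` is
independent of `c` […]. But `ω(x) = p + 2` (resp. `ω(x) = p + 1`) for `c = 0` (resp. for `c ≠ 0`)."

Dictionary: variables `0,1,2` are `u₁,u₂,u₃`; `exc = {0,1}` (`E = div(u₁u₂)`);
`F = U₁U₂U₃^p + U₁^{p+2} + U₂^{p+2} + c·U₃U₂U₁^p = y^{d_A} + y^{d_B} + y^{d_C} + c·y^{d_D}` with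
`d_A = e₀ + e₁ + p e₂`, `d_B = (p+2) e₀`, `d_C = (p+2) e₁`, `d_D = e₂ + e₁ + p e₀`; `r = 0`.
The model field `K` carries `[CharP K p]` wherever `V` is evaluated: the model reads `V ≠ 0` as
`∂F_{p,Z}/∂U₃ ≠ 0`, which is Prop. 2.16 (i) exactly when `char K = p` (`∂(U₁U₂U₃^p)/∂U₃ = p·U₁U₂U₃^{p-1}`
vanishes iff `p = 0` in `K`).

Computed, for every `p` and every `c`: `ord₀ F = p + 2` (`= p δ(x)`), `H_{u₁} = H_{u₂} = 0`,
`ε(x) = p + 2` — all independent of `c`, as the polyhedron is; and, for `char K = p`: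
`∂F_{p,Z}/∂U₃ = c·U₂U₁^p`, so `V(F_{p,Z},E,m_S) ≠ 0 ⟺ c ≠ 0`, `ω(x) = p + 2` for `c = 0` and
`ω(x) = p + 1` for `c ≠ 0` — the printed values.  Nothing is asserted about `Δ_S`, `δ(x)` as a
rational number, or well-adaptedness (the model has no polyhedron); only the two values of `ω`.
AI-assisted formalisation (observatory `pub-rosobs`, unit `pub-rosobs-carver-g25`); quotation from
arXiv:1412.0868, PDF page 24 (Def. 2.16 and Remark 2.6), Prop. 2.16 on page 21.
-/

noncomputable section

open MvPolynomial Finset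

open scoped BigOperators

namespace Literature.AlgebraicGeometry.Resolution

open Literature.AlgebraicGeometry.Resolution.Hauser2010
open Literature.AlgebraicGeometry.Resolution.HauserPerlega2019 (initialForm)

namespace CentreBlowup

section Remark26

variable {K : Type*} [Field K]

/-- [CP19, Remark 2.6]: "`in_{m_S} h = Z^p + U₁U₂U₃^p + U₁^{p+2} + U₂^{p+2} + c U₃U₂U₁^p`,
`E = div(u₁u₂)`" (variables `0,1,2` for `u₁,u₂,u₃`; `r = 0`). [cite: CossartPiltant2019, Remark 2.6 (p. 24)] -/
def cp19Remark26 (p : ℕ) (c : K) : CState (Fin 3) K where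
  F := X 0 * X 1 * X 2 ^ p + X 0 ^ (p + 2) + X 1 ^ (p + 2) + C c * (X 2 * X 1 * X 0 ^ p)
  r := 0
  exc := {0, 1}

/-! #### The four exponents -/

/-- `(d_A)_{u₁} = 1`. [cite: CossartPiltant2019, Remark 2.6 (p. 24)] -/
theorem cp19Remark26ExpA_zero (p : ℕ) :
    (Finsupp.single 0 1 + Finsupp.single 1 1 + Finsupp.single 2 p : Fin 3 →₀ ℕ) 0 = 1 := by simp

/-- `(d_A)_{u₂} = 1`. [cite: CossartPiltant2019, Remark 2.6 (p. 24)] -/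
theorem cp19Remark26ExpA_one (p : ℕ) :
    (Finsupp.single 0 1 + Finsupp.single 1 1 + Finsupp.single 2 p : Fin 3 →₀ ℕ) 1 = 1 := by simp

/-- `(d_A)_{u₃} = p`. [cite: CossartPiltant2019, Remark 2.6 (p. 24)] -/
theorem cp19Remark26ExpA_two (p : ℕ) :
    (Finsupp.single 0 1 + Finsupp.single 1 1 + Finsupp.single 2 p : Fin 3 →₀ ℕ) 2 = p := by simp

/-- `(d_B)_{u₂} = 0`. [cite: CossartPiltant2019, Remark 2.6 (p. 24)] -/
theorem cp19Remark26ExpB_one (p : ℕ) : (Finsupp.single 0 (p + 2) : Fin 3 →₀ ℕ) 1 = 0 := by simp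

/-- `(d_B)_{u₃} = 0`. [cite: CossartPiltant2019, Remark 2.6 (p. 24)] -/
theorem cp19Remark26ExpB_two (p : ℕ) : (Finsupp.single 0 (p + 2) : Fin 3 →₀ ℕ) 2 = 0 := by simp

/-- `(d_C)_{u₁} = 0`. [cite: CossartPiltant2019, Remark 2.6 (p. 24)] -/
theorem cp19Remark26ExpC_zero (p : ℕ) : (Finsupp.single 1 (p + 2) : Fin 3 →₀ ℕ) 0 = 0 := by simp

/-- `(d_C)_{u₂} = p + 2`. [cite: CossartPiltant2019, Remark 2.6 (p. 24)] -/
theorem cp19Remark26ExpC_one (p : ℕ) : (Finsupp.single 1 (p + 2) : Fin 3 →₀ ℕ) 1 = p + 2 := by simp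

/-- `(d_C)_{u₃} = 0`. [cite: CossartPiltant2019, Remark 2.6 (p. 24)] -/
theorem cp19Remark26ExpC_two (p : ℕ) : (Finsupp.single 1 (p + 2) : Fin 3 →₀ ℕ) 2 = 0 := by simp

/-- `(d_D)_{u₁} = p`. [cite: CossartPiltant2019, Remark 2.6 (p. 24)] -/
theorem cp19Remark26ExpD_zero (p : ℕ) :
    (Finsupp.single 2 1 + Finsupp.single 1 1 + Finsupp.single 0 p : Fin 3 →₀ ℕ) 0 = p := by simp

/-- `(d_D)_{u₂} = 1`. [cite: CossartPiltant2019, Remark 2.6 (p. 24)] -/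
theorem cp19Remark26ExpD_one (p : ℕ) :
    (Finsupp.single 2 1 + Finsupp.single 1 1 + Finsupp.single 0 p : Fin 3 →₀ ℕ) 1 = 1 := by simp

/-- `(d_D)_{u₃} = 1`. [cite: CossartPiltant2019, Remark 2.6 (p. 24)] -/
theorem cp19Remark26ExpD_two (p : ℕ) :
    (Finsupp.single 2 1 + Finsupp.single 1 1 + Finsupp.single 0 p : Fin 3 →₀ ℕ) 2 = 1 := by simp

/-- `|d_A| = p + 2`. [cite: CossartPiltant2019, Remark 2.6 (p. 24)] -/
theorem degree_cp19Remark26ExpA (p : ℕ) :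
    (Finsupp.single 0 1 + Finsupp.single 1 1 + Finsupp.single 2 p : Fin 3 →₀ ℕ).degree = p + 2 := by
  rw [map_add, map_add, Finsupp.degree_single, Finsupp.degree_single, Finsupp.degree_single]
  omega

/-- `|d_D| = p + 2`. [cite: CossartPiltant2019, Remark 2.6 (p. 24)] -/
theorem degree_cp19Remark26ExpD (p : ℕ) :
    (Finsupp.single 2 1 + Finsupp.single 1 1 + Finsupp.single 0 p : Fin 3 →₀ ℕ).degree = p + 2 := by
  rw [map_add, map_add, Finsupp.degree_single, Finsupp.degree_single, Finsupp.degree_single]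
  omega

/-- `d_A ≠ d_B`. [cite: CossartPiltant2019, Remark 2.6 (p. 24)] -/
theorem cp19Remark26ExpA_ne_ExpB (p : ℕ) :
    (Finsupp.single 0 1 + Finsupp.single 1 1 + Finsupp.single 2 p : Fin 3 →₀ ℕ) ≠
      Finsupp.single 0 (p + 2) := by
  intro h
  have h1 := DFunLike.congr_fun h 1
  rw [cp19Remark26ExpA_one, cp19Remark26ExpB_one] at h1
  exact one_ne_zero h1

/-- `d_C ≠ d_B`. [cite: CossartPiltant2019, Remark 2.6 (p. 24)] -/
theorem cp19Remark26ExpC_ne_ExpB (p : ℕ) :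
    (Finsupp.single 1 (p + 2) : Fin 3 →₀ ℕ) ≠ Finsupp.single 0 (p + 2) := by
  intro h
  have h1 := DFunLike.congr_fun h 1
  rw [cp19Remark26ExpC_one, cp19Remark26ExpB_one] at h1
  omega

/-- `d_D ≠ d_B`. [cite: CossartPiltant2019, Remark 2.6 (p. 24)] -/
theorem cp19Remark26ExpD_ne_ExpB (p : ℕ) :
    (Finsupp.single 2 1 + Finsupp.single 1 1 + Finsupp.single 0 p : Fin 3 →₀ ℕ) ≠
      Finsupp.single 0 (p + 2) := by
  intro h
  have h1 := DFunLike.congr_fun h 1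
  rw [cp19Remark26ExpD_one, cp19Remark26ExpB_one] at h1
  exact one_ne_zero h1

/-- `d_A ≠ d_C`. [cite: CossartPiltant2019, Remark 2.6 (p. 24)] -/
theorem cp19Remark26ExpA_ne_ExpC (p : ℕ) :
    (Finsupp.single 0 1 + Finsupp.single 1 1 + Finsupp.single 2 p : Fin 3 →₀ ℕ) ≠
      Finsupp.single 1 (p + 2) := by
  intro h
  have h0 := DFunLike.congr_fun h 0
  rw [cp19Remark26ExpA_zero, cp19Remark26ExpC_zero] at h0
  exact one_ne_zero h0

/-- `d_B ≠ d_C`. [cite: CossartPiltant2019, Remark 2.6 (p. 24)] -/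
theorem cp19Remark26ExpB_ne_ExpC (p : ℕ) :
    (Finsupp.single 0 (p + 2) : Fin 3 →₀ ℕ) ≠ Finsupp.single 1 (p + 2) :=
  (cp19Remark26ExpC_ne_ExpB p).symm

/-- `d_D ≠ d_C`. [cite: CossartPiltant2019, Remark 2.6 (p. 24)] -/
theorem cp19Remark26ExpD_ne_ExpC (p : ℕ) :
    (Finsupp.single 2 1 + Finsupp.single 1 1 + Finsupp.single 0 p : Fin 3 →₀ ℕ) ≠
      Finsupp.single 1 (p + 2) := by
  intro h
  have h2 := DFunLike.congr_fun h 2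
  rw [cp19Remark26ExpD_two, cp19Remark26ExpC_two] at h2
  exact one_ne_zero h2

/-! #### `F`, `ord₀ F`, `H`, `ε(x)` — independent of `c` -/

/-- `F = y^{d_A} + y^{d_B} + y^{d_C} + c·y^{d_D}`. [cite: CossartPiltant2019, Remark 2.6 (p. 24)] -/
theorem cp19Remark26_F (p : ℕ) (c : K) :
    (cp19Remark26 p c : CState (Fin 3) K).F =
      monomial (Finsupp.single 0 1 + Finsupp.single 1 1 + Finsupp.single 2 p) 1 +
        monomial (Finsupp.single 0 (p + 2)) 1 + monomial (Finsupp.single 1 (p + 2)) 1 +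
        monomial (Finsupp.single 2 1 + Finsupp.single 1 1 + Finsupp.single 0 p) c := by
  show (X 0 * X 1 * X 2 ^ p + X 0 ^ (p + 2) + X 1 ^ (p + 2) + C c * (X 2 * X 1 * X 0 ^ p) :
    MvPolynomial (Fin 3) K) = _
  have h0 : (X 0 : MvPolynomial (Fin 3) K) = monomial (Finsupp.single 0 1) 1 := rfl
  have h1 : (X 1 : MvPolynomial (Fin 3) K) = monomial (Finsupp.single 1 1) 1 := rfl
  have h2 : (X 2 : MvPolynomial (Fin 3) K) = monomial (Finsupp.single 2 1) 1 := rfl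
  rw [X_pow_eq_monomial, X_pow_eq_monomial, X_pow_eq_monomial, X_pow_eq_monomial, h0, h1, h2]
  simp only [monomial_mul, C_mul_monomial, mul_one]

/-- The coefficient of `U₁^{p+2}` in `F` is `1`. [cite: CossartPiltant2019, Remark 2.6 (p. 24)] -/
theorem cp19Remark26_coeff_ExpB (p : ℕ) (c : K) :
    coeff (Finsupp.single 0 (p + 2)) (cp19Remark26 p c : CState (Fin 3) K).F = 1 := by
  rw [cp19Remark26_F, coeff_add, coeff_add, coeff_add, coeff_monomial, coeff_monomial, coeff_monomial,
    coeff_monomial, if_neg (cp19Remark26ExpA_ne_ExpB p), if_pos rfl, if_neg (cp19Remark26ExpC_ne_ExpB p),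
    if_neg (cp19Remark26ExpD_ne_ExpB p), zero_add, add_zero, add_zero]

/-- The coefficient of `U₂^{p+2}` in `F` is `1`. [cite: CossartPiltant2019, Remark 2.6 (p. 24)] -/
theorem cp19Remark26_coeff_ExpC (p : ℕ) (c : K) :
    coeff (Finsupp.single 1 (p + 2)) (cp19Remark26 p c : CState (Fin 3) K).F = 1 := by
  rw [cp19Remark26_F, coeff_add, coeff_add, coeff_add, coeff_monomial, coeff_monomial, coeff_monomial,
    coeff_monomial, if_neg (cp19Remark26ExpA_ne_ExpC p), if_neg (cp19Remark26ExpB_ne_ExpC p), if_pos rfl,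
    if_neg (cp19Remark26ExpD_ne_ExpC p), zero_add, zero_add, add_zero]

/-- `F` is a form of degree `p + 2 = p δ(x)` ("`δ(x) = 1 + 2/p`"). [cite: CossartPiltant2019, Remark 2.6 (p. 24)] -/
theorem cp19Remark26_isHomogeneous (p : ℕ) (c : K) :
    ((cp19Remark26 p c : CState (Fin 3) K).F).IsHomogeneous (p + 2) := by
  rw [cp19Remark26_F]
  exact (((isHomogeneous_monomial _ (degree_cp19Remark26ExpA p)).add
    (isHomogeneous_monomial _ (Finsupp.degree_single _ _))).add
    (isHomogeneous_monomial _ (Finsupp.degree_single _ _))).add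
    (isHomogeneous_monomial _ (degree_cp19Remark26ExpD p))

/-- `ord₀ F = p + 2`, for every `c`. [cite: CossartPiltant2019, Remark 2.6 (p. 24)] -/
theorem cp19Remark26_ordZero (p : ℕ) (c : K) :
    ordZero (cp19Remark26 p c : CState (Fin 3) K).F = (p + 2 : ℕ) := by
  refine (ordZero_eq_nat_iff _ (p + 2)).mpr ⟨⟨Finsupp.single 0 (p + 2), ?_, Finsupp.degree_single _ _⟩, ?_⟩
  · rw [cp19Remark26_coeff_ExpB]; exact one_ne_zero
  · intro d hd
    exact (cp19Remark26_isHomogeneous p c).coeff_eq_zero hd.ne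

/-- `H_j = 0` for every `j` (`U₂^{p+2}` is prime to `u₁`, `U₁^{p+2}` to `u₂`, `u₃`), for every `c`.
[cite: CossartPiltant2019, Remark 2.6 (p. 24) with Def. 2.10] -/
theorem cp19Remark26_bigH (p : ℕ) (c : K) (j : Fin 3) :
    PointBlowup.bigH (cp19Remark26 p c : CState (Fin 3) K).F j = 0 := by
  have hj : j = 0 ∨ (j = 1 ∨ j = 2) := by revert j; decide
  have hB : (Finsupp.single 0 (p + 2) : Fin 3 →₀ ℕ) ∈ (cp19Remark26 p c : CState (Fin 3) K).F.support := by
    rw [mem_support_iff, cp19Remark26_coeff_ExpB]; exact one_ne_zero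
  have hC : (Finsupp.single 1 (p + 2) : Fin 3 →₀ ℕ) ∈ (cp19Remark26 p c : CState (Fin 3) K).F.support := by
    rw [mem_support_iff, cp19Remark26_coeff_ExpC]; exact one_ne_zero
  have hB' : PointBlowup.bigH (cp19Remark26 p c : CState (Fin 3) K).F j ≤
      (Finsupp.single 0 (p + 2) : Fin 3 →₀ ℕ) j :=
    Finset.inf_le (f := fun d : Fin 3 →₀ ℕ => ((d j : ℕ) : ℕ∞)) hB
  have hC' : PointBlowup.bigH (cp19Remark26 p c : CState (Fin 3) K).F j ≤
      (Finsupp.single 1 (p + 2) : Fin 3 →₀ ℕ) j :=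
    Finset.inf_le (f := fun d : Fin 3 →₀ ℕ => ((d j : ℕ) : ℕ∞)) hC
  rcases hj with rfl | (rfl | rfl)
  · rw [cp19Remark26ExpC_zero, Nat.cast_zero] at hC'; exact nonpos_iff_eq_zero.mp hC'
  · rw [cp19Remark26ExpB_one, Nat.cast_zero] at hB'; exact nonpos_iff_eq_zero.mp hB'
  · rw [cp19Remark26ExpB_two, Nat.cast_zero] at hB'; exact nonpos_iff_eq_zero.mp hB'

/-- `ε(x) = p δ(x) − (H_{u₁} + H_{u₂}) = p + 2`, for every `c`. [cite: CossartPiltant2019, Remark 2.6 (p. 24) with Def. 2.10] -/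
theorem cp19Remark26_epsilon (p : ℕ) (c : K) :
    (cp19Remark26 p c : CState (Fin 3) K).epsilon = (p + 2 : ℕ) := by
  rw [CState.epsilon_eq, Finset.sum_eq_zero (fun j _ => cp19Remark26_bigH p c j), tsub_zero,
    cp19Remark26_ordZero]

/-- `F_{p,Z} = F` (a form). [cite: CossartPiltant2019, Remark 2.6 (p. 24)] -/
theorem cp19Remark26_initialForm (p : ℕ) (c : K) :
    initialForm (cp19Remark26 p c : CState (Fin 3) K).F = (cp19Remark26 p c : CState (Fin 3) K).F := by
  unfold HauserPerlega2019.initialForm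
  rw [cp19Remark26_ordZero, ENat.toNat_coe]
  exact homogeneousComponent_eq_self (cp19Remark26_isHomogeneous p c)

/-! #### `V` and `ω(x)` in characteristic `p` — they depend on `c` -/

/-- In characteristic `p`: `∂F_{p,Z}/∂U₃ = c·U₂U₁^p` (the term `p·U₁U₂U₃^{p-1}` vanishes).
[cite: CossartPiltant2019, Remark 2.6 (p. 24) with Prop. 2.16 (i) (p. 21)] -/
theorem cp19Remark26_pderiv (p : ℕ) [CharP K p] (c : K) :
    pderiv 2 (initialForm (cp19Remark26 p c : CState (Fin 3) K).F) =
      monomial (Finsupp.single 1 1 + Finsupp.single 0 p) c := by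
  have hD : (Finsupp.single 2 1 + Finsupp.single 1 1 + Finsupp.single 0 p : Fin 3 →₀ ℕ) -
      Finsupp.single 2 1 = Finsupp.single 1 1 + Finsupp.single 0 p := by
    rw [add_assoc, add_tsub_cancel_left]
  rw [cp19Remark26_initialForm, cp19Remark26_F, map_add, map_add, map_add, pderiv_monomial,
    pderiv_monomial, pderiv_monomial, pderiv_monomial, cp19Remark26ExpA_two, cp19Remark26ExpB_two,
    cp19Remark26ExpC_two, cp19Remark26ExpD_two, CharP.cast_eq_zero, Nat.cast_zero, mul_zero,
    Nat.cast_one, mul_one, hD]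
  simp only [monomial_zero, zero_add]

/-- "`V(F_{p,Z},E,m_S) ≠ 0`" exactly when `c ≠ 0` (characteristic `p`; `u₃` is the only variable off
`E = div(u₁u₂)`). [cite: CossartPiltant2019, Remark 2.6 (p. 24) with Prop. 2.16 (i) (p. 21)] -/
theorem cp19Remark26_vNonzero_iff (p : ℕ) [CharP K p] (c : K) :
    PointBlowup.VNonzero (cp19Remark26 p c : CState (Fin 3) K).exc
      (cp19Remark26 p c : CState (Fin 3) K).F ↔ c ≠ 0 := by
  constructor
  · rintro ⟨j, hj, hne⟩
    have hall : ∀ i : Fin 3, i ∉ ({0, 1} : Finset (Fin 3)) → i = 2 := by decide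
    have hj2 : j = 2 := hall j hj
    subst hj2
    rwa [cp19Remark26_pderiv, Ne, monomial_eq_zero] at hne
  · intro hc
    refine ⟨2, (show (2 : Fin 3) ∉ ({0, 1} : Finset (Fin 3)) by decide), ?_⟩
    rw [cp19Remark26_pderiv, Ne, monomial_eq_zero]
    exact hc

/-- "`ω(x) = p + 2` […] for `c = 0`" (characteristic `p`). [cite: CossartPiltant2019, Remark 2.6 (p. 24)] -/
theorem cp19Remark26_omega_zero (p : ℕ) [CharP K p] :
    (cp19Remark26 p (0 : K) : CState (Fin 3) K).omega = (p + 2 : ℕ) := by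
  rw [CState.omega_eq_of_not_vNonzero _ (fun h => (cp19Remark26_vNonzero_iff p (0 : K)).mp h rfl),
    cp19Remark26_epsilon]

/-- "`ω(x) = p + 1` […] for `c ≠ 0`" (characteristic `p`). [cite: CossartPiltant2019, Remark 2.6 (p. 24)] -/
theorem cp19Remark26_omega_ne_zero (p : ℕ) [CharP K p] {c : K} (hc : c ≠ 0) :
    (cp19Remark26 p c : CState (Fin 3) K).omega = (p + 1 : ℕ) := by
  have h : p + 2 - 1 = p + 1 := by omega
  rw [CState.omega_eq_of_vNonzero _ ((cp19Remark26_vNonzero_iff p c).mpr hc), cp19Remark26_epsilon,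
    ← ENat.coe_one, ← ENat.coe_sub, h]

/-- **[CP19, Remark 2.6] in the model.** In characteristic `p`, the states
`h = Z^p + U₁U₂U₃^p + U₁^{p+2} + U₂^{p+2} + c U₃U₂U₁^p`, `E = div(u₁u₂)` have the same `ord₀ F = p + 2`,
`H = 0` and `ε(x) = p + 2` for every `c`, but `ω(x) = p + 2` for `c = 0` and `ω(x) = p + 1` for `c ≠ 0`:
"`ω(x)` is not determined by the characteristic polyhedra". [cite: CossartPiltant2019, Remark 2.6 (p. 24)] -/
theorem cp19Remark26_summary (p : ℕ) [CharP K p] :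
    (∀ c : K, (cp19Remark26 p c : CState (Fin 3) K).epsilon = (p + 2 : ℕ)) ∧
      (cp19Remark26 p (0 : K) : CState (Fin 3) K).omega = (p + 2 : ℕ) ∧
      ∀ c : K, c ≠ 0 → (cp19Remark26 p c : CState (Fin 3) K).omega = (p + 1 : ℕ) :=
  ⟨cp19Remark26_epsilon p, cp19Remark26_omega_zero p, fun _ hc => cp19Remark26_omega_ne_zero p hc⟩

end Remark26

end CentreBlowup

end Literature.AlgebraicGeometry.Resolution

end
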